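import Summits.SmoothPoincare4.SmoothPoincare4.Theorems.ShadowApproximation.Negative.ShadowsOnlyFalse

/-!
# `ShadowApproximation` — line `epi-class-livingston`: vocabulary (handlebody avatars, framings,
# Livingston–Zimmermann stable equivalence)

Definitions file of the proof line `epi-class-livingston` for the crux
`CongruenceShadows.ShadowApproximation` (item stmt-SmoothPoincare4-14595, route
route-SmoothPoincare4-CongruenceShadows; checked skeleton
`Cruxes/ShadowApproximation/Lines/epi-class-livingston.lean`, lead prover
prover-line-stmt-SmoothPoincare4-14595-0).  It carries ONLY the objects the line posits, so that
the registered stubs of the skeleton and the stub files `Theorems/CongruenceShadowsShadowApproximationStub*.lean`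
refer to the same declarations:

* `S m = SurfaceGroup (3+3m)`, `N m = s4Kernels.stabilizeIter m` (the standard `(3+3m; m+1)`
  kernel triple of `S⁴`), the normality instance `stdKernel_normal`, the standard handlebody groups
  `H m i = S m ⧸ N m i` (`π₁` of the `i`-th standard handlebody) and `T m = Π i, H m i`;
* the **standard handlebody avatar** `stdPhi m : S m →* T m`, `s ↦ (s mod N₀, s mod N₁, s mod N₂)`,
  and its image `Pstd m` (at `m = 0` the subdirect product
  `{x̄₁ = ȳ₁, x̄₂ = z̄₂, ȳ₃ = z̄₃} ≤ F₃³ ⊇ γ₂(F₃)³` of the idea card);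
* the crux hypotheses as predicates: `Pairs m K` (Waldhausen normalisation `hW`) and `Shadows m K`
  (standard shadows in every characteristic finite quotient, `hS`, verbatim);
* `IsFraming m K φ` — epimorphisms `φᵢ : S ↠ π₁(Hᵢ)` with `ker φᵢ = Kᵢ` and joint image `Pstd m`;
* `collapse3`, `collapseIter` — killing `3n` added handles `S_{g+3n} ↠ S_g` (from
  `surfaceRelator_add_three`), and **Livingston–Zimmermann stable equivalence**
  `StablyEquivalent m Φ Ψ` of homomorphisms out of `S m` (Livingston 1985, Zimmermann 1987; for `Ψ`
  onto `G` it is `Φ_*[Σ] = ±Ψ_*[Σ] ∈ H₂(G;ℤ)`, Dunfield–Thurston 2006 Thm 6.8 — used here only as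
  motivation: the predicate is typed without group homology);
* `SigmaStandard m Φ` (σ-standard: `β ∘ Φ` stably equivalent to `Φ_N` for some coordinate
  automorphisms `β`), `Equivalent m Φ` (`Φ_N = β ∘ Φ ∘ θ`);
* the three statement schemas of the line: `ConstantAvatarAt m` (dictionary / Nielsen level),
  `SeparationAt m` (load-bearing), `CancellationAt m` (residual).

No theorem of substance is proved here (only `rfl`/`simp` bookkeeping); the certificates
(`parts_of_crux`, `gate_of_parts`, …) live in the skeleton, the stubs in their own files.
Sources: Abrams–Gay–Kirby 2018 (arXiv:1605.06731) §1–2 for group trisections and `s4Kernels`;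
C. Livingston, *Stabilizing surface symmetries*, Michigan Math. J. 32 (1985); B. Zimmermann,
*Surfaces and the second homology of a group*, Monatsh. Math. 104 (1987); N. Dunfield,
W. Thurston, *Finite covers of random 3-manifolds*, Invent. Math. 166 (2006), §6.
-/

noncomputable section

-- the prescribed namespace `Summit.<P>.<Sub>.…` duplicates `SmoothPoincare4` (P = Sub)
set_option linter.dupNamespace false

namespace Summit.SmoothPoincare4.SmoothPoincare4.Theorems.ShadowApproximation.EpiClassLivingston

open Literature.Topology.FourManifolds

/-- `S_g` at the crux's genus `g = 3 + 3m`. -/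
abbrev S (m : ℕ) : Type := SurfaceGroup (3 + 3 * m)

/-- The standard kernel triple `N = s4Kernels # … # s4Kernels` of genus `3 + 3m`. -/
abbrev N (m : ℕ) : TrisectionKernels (3 + 3 * m) := s4Kernels.stabilizeIter m

/-- The standard kernels are normal closures, hence normal (so `S m ⧸ N m i` is a group). -/
instance stdKernel_normal (m : ℕ) (i : Fin 3) : (s4Kernels.stabilizeIter m i).Normal := by
  cases m with
  | zero =>
    show (s4Kernels i).Normal
    rw [s4Kernels_eq]
    infer_instance
  | succ n =>
    show ((s4Kernels.stabilizeIter n).stabilize i).Normal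
    rw [TrisectionKernels.stabilize_apply]
    infer_instance

/-- The `i`-th standard handlebody group `π₁(Hᵢ) = S ⧸ Nᵢ` (free of rank `3(m+1)` by
`IsGroupTrisection.free_quotient`; at `m = 0` it is `F₃` on the three surviving generators). -/
abbrev H (m : ℕ) (i : Fin 3) : Type := S m ⧸ N m i

/-- The target of handlebody avatars: `Π i, π₁(Hᵢ)` (at `m = 0`: `F₃ × F₃ × F₃`). -/
abbrev T (m : ℕ) : Type := ∀ i : Fin 3, H m i

/-- **The standard handlebody avatar** `Φ_N = (s ↦ s mod Nᵢ)ᵢ : S → Π π₁(Hᵢ)`. -/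
def stdPhi (m : ℕ) : S m →* T m :=
  MonoidHom.pi fun i => QuotientGroup.mk' (N m i)

/-- Coordinates of the standard avatar: `Φ_N(s)ᵢ = s mod Nᵢ`. [folklore] -/
@[simp] theorem stdPhi_apply (m : ℕ) (s : S m) (i : Fin 3) :
    stdPhi m s i = (s : H m i) := rfl

/-- **The standard joint image** `P_std = Φ_N(S) ≤ Π π₁(Hᵢ)` (at `m = 0` the subdirect product
`{x̄₁ = ȳ₁, x̄₂ = z̄₂, ȳ₃ = z̄₃} ≤ F₃³`, containing `γ₂(F₃)³`). -/
def Pstd (m : ℕ) : Subgroup (T m) := (stdPhi m).range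

/-- Waldhausen normalisation (the crux's `hW`): each pair of slots simultaneously standard. -/
def Pairs (m : ℕ) (K : TrisectionKernels (3 + 3 * m)) : Prop :=
  ∀ i j : Fin 3, i ≠ j → ∃ α : S m ≃* S m,
    (N m i).map α.toMonoidHom = K i ∧ (N m j).map α.toMonoidHom = K j

/-- Standard shadows in every characteristic finite quotient (the crux's `hS`, VERBATIM: the level
symmetry is whatever `ψ` induces — not required to lift anywhere). -/
def Shadows (m : ℕ) (K : TrisectionKernels (3 + 3 * m)) : Prop :=
  ∀ M : Subgroup (S m), M.Characteristic → M.FiniteIndex →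
    ∃ ψ : S m ≃* S m, ∀ i : Fin 3, (N m i ⊔ M).map ψ.toMonoidHom = K i ⊔ M

/-- Genus bookkeeping is definitional: `N 0 = s4Kernels` (and `S 0 = SurfaceGroup 3`, `3 + 3·0 = 3`). -/
theorem N_zero : N 0 = s4Kernels := rfl



/-- **Framing** of a kernel triple by the standard handlebody groups: epimorphisms
`φᵢ : S → π₁(Hᵢ^N)` with `ker φᵢ = Kᵢ` whose JOINT image is the standard one, `Φ_K(S) = P_std`. -/
def IsFraming (m : ℕ) (K : TrisectionKernels (3 + 3 * m)) (φ : ∀ i : Fin 3, S m →* H m i) : Prop :=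
  (∀ i, (φ i).ker = K i) ∧ (MonoidHom.pi φ).range = Pstd m

/-! ### Killing handles, and Livingston–Zimmermann stable equivalence -/

/-- Generator images of the collapse `S_{g+3} → S_g`: keep the first `g` handles, kill the last
three. -/
def keepFun (g : ℕ) (c : surfaceGen (g + 3)) : SurfaceGroup g :=
  Fin.append (fun i : Fin g => (PresentedGroup.of (i, c.2) : SurfaceGroup g))
    (fun _ : Fin 3 => (1 : SurfaceGroup g)) c.1

/-- The free lift of `keepFun` restricted to the first `g` handles is the projection `F → S_g`. [folklore] -/
theorem lift_keepFun_comp_genIncl (g : ℕ) :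
    (FreeGroup.lift (keepFun g)).comp (genIncl g) = PresentedGroup.mk _ :=
  FreeGroup.ext_hom _ _ fun p => by simp [keepFun, PresentedGroup.of]

/-- The free lift of `keepFun` kills the last three handles. [folklore] -/
theorem lift_keepFun_comp_genShift (g : ℕ) :
    (FreeGroup.lift (keepFun g)).comp (genShift g) = 1 :=
  FreeGroup.ext_hom _ _ fun p => by simp [keepFun]

/-- Pointwise form of `lift_keepFun_comp_genIncl`. [folklore] -/
theorem lift_keepFun_genIncl (g : ℕ) (x : FreeGroup (surfaceGen g)) :
    FreeGroup.lift (keepFun g) (genIncl g x) = PresentedGroup.mk _ x :=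
  DFunLike.congr_fun (lift_keepFun_comp_genIncl g) x

/-- Pointwise form of `lift_keepFun_comp_genShift`. [folklore] -/
theorem lift_keepFun_genShift (g : ℕ) (x : FreeGroup (surfaceGen 3)) :
    FreeGroup.lift (keepFun g) (genShift g x) = 1 :=
  DFunLike.congr_fun (lift_keepFun_comp_genShift g) x

/-- **Collapse of the last three handles** `S_{g+3} ↠ S_g` (`aⱼ, bⱼ ↦ aⱼ, bⱼ` for `j < g`,
`a_{g+k}, b_{g+k} ↦ 1`): the relator `r_{g+3} = ι(r_g)·σ(r_3)` dies. On `π₁` this is the map of the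
degree-one collapse `Σ_{g+3} = Σ_g # Σ_3 → Σ_g`. -/
def collapse3 (g : ℕ) : SurfaceGroup (g + 3) →* SurfaceGroup g :=
  presentedLift (FreeGroup.lift (keepFun g)) (by
    intro r hr
    rw [Set.mem_singleton_iff] at hr
    subst hr
    rw [surfaceRelator_add_three, map_mul, lift_keepFun_genIncl, lift_keepFun_genShift,
      PresentedGroup.one_of_mem (Set.mem_singleton _), one_mul])

/-- `collapse3` is the identity on the first `g` handles. [folklore] -/
@[simp] theorem collapse3_of_castAdd (g : ℕ) (i : Fin g) (s : Bool) :
    collapse3 g (PresentedGroup.of (Fin.castAdd 3 i, s)) = PresentedGroup.of (i, s) := by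
  simp [collapse3, keepFun, PresentedGroup.of]

/-- `collapse3` kills the last three handles. [folklore] -/
@[simp] theorem collapse3_of_natAdd (g : ℕ) (j : Fin 3) (s : Bool) :
    collapse3 g (PresentedGroup.of (Fin.natAdd g j, s)) = 1 := by
  simp [collapse3, keepFun, PresentedGroup.of]

/-- Collapse of `3n` added handles, `S_{g+3n} ↠ S_g` (Livingston's stabilisation by trivially mapped
handles, three at a time — any cofinal stabilisation scheme gives the same stable relation). -/
def collapseIter (g : ℕ) : (n : ℕ) → (SurfaceGroup (g + 3 * n) →* SurfaceGroup g)
  | 0 => MonoidHom.id _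
  | n + 1 => (collapseIter g n).comp (collapse3 (g + 3 * n))

/-- Zero-fold collapse is the identity. [folklore] -/
@[simp] theorem collapseIter_zero (g : ℕ) : collapseIter g 0 = MonoidHom.id _ := rfl

/-- Unfolding one step of `collapseIter`. [folklore] -/
theorem collapseIter_succ (g n : ℕ) :
    collapseIter g (n + 1) = (collapseIter g n).comp (collapse3 (g + 3 * n)) := rfl

/-- **Livingston–Zimmermann stable equivalence** of two homomorphisms `S_{3+3m} → G`: after adding
`3n` handles mapped trivially they differ by an automorphism (`±` mapping class, Dehn–Nielsen–Baer)
of the stabilised surface group. For `Ψ` onto `G` this is equivalent to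
`Φ_*[Σ] = ±Ψ_*[Σ] ∈ H₂(G;ℤ)` (Livingston 1985, Zimmermann 1987; Dunfield–Thurston 2006 Thm 6.8:
bordism over `K(G,1)` = `H₂`, plus handle cancellation in the bordism). -/
def StablyEquivalent (m : ℕ) {G : Type*} [Group G] (Φ Ψ : S m →* G) : Prop :=
  ∃ (n : ℕ) (θ : SurfaceGroup (3 + 3 * m + 3 * n) ≃* SurfaceGroup (3 + 3 * m + 3 * n)),
    (Φ.comp (collapseIter (3 + 3 * m) n)).comp θ.toMonoidHom = Ψ.comp (collapseIter (3 + 3 * m) n)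

/-- Stable equivalence is reflexive (`n = 0`, `θ = 1`). [folklore] -/
theorem StablyEquivalent.refl (m : ℕ) {G : Type*} [Group G] (Φ : S m →* G) :
    StablyEquivalent m Φ Φ :=
  ⟨0, MulEquiv.refl _, MonoidHom.ext fun _ => rfl⟩

/-- **σ-standard** (the Livingston class of `Φ` is standard up to target framings):
`∃ β ∈ Π Aut π₁(Hᵢ)`, `β ∘ Φ` is stably equivalent to `Φ_N`. For `Φ` onto `P_std` this says
`σ(Φ) := Φ_*[Σ] ∈ ±Aut_Λ · σ(Φ_N)` in `H₂(P_std;ℤ) = H₂(E_Λ;ℤ)`, `E_Λ` the `ℤ³`-cover of `R₃³`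
(card), where `Aut_Λ = Stab_{Π Aut Fᵢ}(P_std)` (a `β` that works stabilises `P_std` automatically,
stable equivalence preserving images). -/
def SigmaStandard (m : ℕ) (Φ : S m →* T m) : Prop :=
  ∃ β : ∀ i : Fin 3, H m i ≃* H m i,
    StablyEquivalent m ((MulEquiv.piCongrRight β).toMonoidHom.comp Φ) (stdPhi m)

/-- **Equivalent to the standard avatar**: `Φ_N = β ∘ Φ ∘ θ` with `θ ∈ Aut S`, `β ∈ Π Aut π₁(Hᵢ)`
(`Φ ∈ Aut_Λ · Φ_N · Aut S`: the orbit whose transitivity on `Epi(S₃, P_std)` is `UnstableGate₃`,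
triage F2/N3). -/
def Equivalent (m : ℕ) (Φ : S m →* T m) : Prop :=
  ∃ (θ : S m ≃* S m) (β : ∀ i : Fin 3, H m i ≃* H m i),
    ∀ s : S m, stdPhi m s = MulEquiv.piCongrRight β (Φ (θ s))

/-! ## 1. Statements of the stubs -/

/-- Statement of `stub_constantAvatarZero` / `stub_constantAvatarPos` at genus `3 + 3m`
(the DICTIONARY `kernel triples ↦ Epi(S, P_std)`): a Waldhausen-normalised, shadow-standard
`(3+3m; m+1)` group trisection of `{1}` admits a framing with the STANDARD joint image. At `m = 0`:
lattice identity `[S,S] ≤ Kᵢ(Kⱼ ∩ Kₗ)` (proved) ⟹ `Φ_K(S) ⊇ γ₂(F₃)³`, so the joint image is the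
preimage of the abelian shadow, which is standard (route support `AbelianShadowStandard` at `m = 0`
/ `hS` at the levels `[S,S]S^n` + class number one, triage N4) — then re-frame by `Aut F₃ ↠ GL₃(ℤ)`.
At `m ≥ 1` it is the Nielsen-level statement that the framed joint image `S/(K₀∩K₁∩K₂)` is
standard (implied by the crux; sibling line `free-shadow-tsystem` territory). -/
def ConstantAvatarAt (m : ℕ) : Prop :=
  ∀ K : TrisectionKernels (3 + 3 * m), IsGroupTrisection (3 + 3 * m) (m + 1) (PUnit : Type) K →
    Pairs m K → Shadows m K → ∃ φ : ∀ i : Fin 3, S m →* H m i, IsFraming m K φ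

/-- Statement of `stub_separation` at genus `3 + 3m` (SEPARATION, the load-bearing bet): for a
framed, normalised group trisection of `{1}`, standard shadows in every characteristic finite
quotient force the Livingston class to be standard — `σ(Φ_K) ∈ ±Aut_Λ·σ(Φ_N)`, typed as stable
equivalence. A local-to-global statement for ONE class in the torsion `ℤ[t₁±,t₂±,t₃±]`-module
`H₂(E_Λ;ℤ)` under the level symmetries (units included: `hS` is consumed verbatim). -/
def SeparationAt (m : ℕ) : Prop :=
  ∀ (K : TrisectionKernels (3 + 3 * m)) (φ : ∀ i : Fin 3, S m →* H m i),
    IsGroupTrisection (3 + 3 * m) (m + 1) (PUnit : Type) K → Pairs m K → Shadows m K →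
    IsFraming m K φ → SigmaStandard m (MonoidHom.pi φ)

/-- Statement of `stub_cancellation` at genus `3 + 3m` (CANCELLATION, the honest residual):
a framed, normalised, shadow-standard group trisection of `{1}` whose avatar is Livingston-stably
standard IS standard — destabilisation of trivially mapped handle triples (by bordism = homology:
simplify the 3-manifold `W`, `∂W = Σ ⊔ Σ̄`, carrying three surface systems interpolating the two
trisection diagrams). Crux-strength on the σ-standard locus (conceded by the card). -/
def CancellationAt (m : ℕ) : Prop :=
  ∀ (K : TrisectionKernels (3 + 3 * m)) (φ : ∀ i : Fin 3, S m →* H m i),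
    IsGroupTrisection (3 + 3 * m) (m + 1) (PUnit : Type) K → Pairs m K → Shadows m K →
    IsFraming m K φ → SigmaStandard m (MonoidHom.pi φ) → Equivalent m (MonoidHom.pi φ)

end Summit.SmoothPoincare4.SmoothPoincare4.Theorems.ShadowApproximation.EpiClassLivingston


/-!
# Line `epi-class-livingston` — crux `CongruenceShadows.ShadowApproximation` (stmt-SmoothPoincare4-14595)

LEAD RESHAPE r1 (prover-line-stmt-SmoothPoincare4-14595-0, 2026-08-16): vocabulary moved to the landed file
`Theorems/CongruenceShadowsShadowApproximationEpiClassLivingstonDefs.lean`; the dictionary stub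
`stub_constantAvatarZero` is split into three registered stubs stated over tree notions —
`stub_latticeIdentity` (1a, `[S,S] ≤ Kᵢ(Kⱼ ∩ Kₗ)`), `stub_autFreeGroupRealisesGL` (1b, `Aut F₃ ↠ GL₃(ℤ)`),
`stub_framingZero` (1c, 1a → 1b → `ConstantAvatarAt 0`) — composed as `constantAvatarZero`; stubs 2–4
unchanged. 6 stubs ≤ stubs_max = 7; composition `ShadowApproximation_of` unchanged in shape.

Skeleton (crux-plan, round 1) for the idea card `epi-class-livingston` (ideator 2; triage
TRIAGE-r1-2: pass, TRIAGE-r1-3: pass, sharpenings (a) kill-switch computation first, (b) level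
symmetries must not be asked to lift — both acted on below).

## The objects (all local, over existing declarations; no new Literature definitions)

* `S m = SurfaceGroup (3+3m)`, `N m = s4Kernels.stabilizeIter m` (standard `(3+3m; m+1)` triple),
  `H m i = S m ⧸ N m i` (= `π₁` of the `i`-th standard handlebody, free of rank `3(m+1)`),
  `T m = Π i, H m i`.
* The **standard handlebody avatar** `stdPhi m : S m →* T m`, `s ↦ (s mod N₀, s mod N₁, s mod N₂)`,
  and its image `Pstd m ≤ T m` (at `m = 0`: the subdirect product
  `P_std = {x̄₁ = ȳ₁, x̄₂ = z̄₂, ȳ₃ = z̄₃} ≤ F₃³ ⊇ γ₂(F₃)³` of the card, by the PROVED lattice identity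
  `[S,S] ≤ Kᵢ(Kⱼ ∩ Kₗ)`, ideator Sketch `tripleMeetCommutator_holds`, triage F1/N2).
* A **framing** of a kernel triple `K` is `φ : Π i, S m →* H m i` with `ker φᵢ = Kᵢ` and joint image
  `range (MonoidHom.pi φ) = Pstd m` (`IsFraming`).
* **Livingston–Zimmermann stable equivalence** `StablyEquivalent m Φ Ψ` of two homs `S m →* G`:
  after killing `3n` added handles (`collapseIter`, built here from `surfaceRelator_add_three`) they
  differ by an automorphism of `S_{3+3m+3n}`. By Livingston 1985 / Zimmermann 1987 (proof by
  bordism, Dunfield–Thurston 2006 Thm 6.8/6.11; `Ω₂(BG) = H₂(G;ℤ)`), for `Ψ` ONTO `G` this is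
  EXACTLY `Φ_*[Σ] = ±Ψ_*[Σ] ∈ H₂(G;ℤ)`. Hence
  `SigmaStandard m Φ := ∃ β ∈ Π Aut(H m i), StablyEquivalent (β ∘ Φ) (stdPhi m)` is the card's
  "`σ(Φ) ∈ ±Aut_Λ · σ(Φ_N)` in `H₂(P_std;ℤ) = H₂(E_Λ;ℤ)`", typed WITHOUT group homology.
* `Equivalent m Φ := ∃ θ ∈ Aut S, β ∈ Π Aut(H m i), stdPhi = β ∘ Φ ∘ θ` (`Φ ∈ Aut_Λ · Φ_N · Aut S`).

## Stubs (sorried, registered) and composition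

* `stub_constantAvatarZero` — DICTIONARY at genus 3 (provable now, size L): every Waldhausen-
  normalised, shadow-standard `(3;1,1,1)` group trisection of `{1}` has a framing onto `Pstd 0`.
* `stub_constantAvatarPos` — the same at `m ≥ 1` (Nielsen level: the framed JOINT image
  `S/(K₀∩K₁∩K₂) ≤ Π F_{3k}` is standard; weaker than the crux, open).
* `stub_separation` — SEPARATION (LOAD-BEARING bet): standard characteristic shadows (`hS`, verbatim:
  level symmetries are whatever `ψ_M ∈ Aut S` induces, units included — they are NOT asked to
  lift) force the Livingston class to be standard: `SigmaStandard`.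
* `stub_cancellation` — CANCELLATION (RESIDUAL, crux-strength on the σ-standard locus):
  Livingston-stably standard ⟹ standard (destabilisation of trivially-mapped handle triples; the
  bordism 3-manifold `W` with three surface systems).
* Composition (sorry-free glue): `iso_of_equivalent` (kernel bookkeeping `stdPhi = βΦθ ⟹ θ(Nᵢ) = Kᵢ`),
  `gate_of_parts`, `gate_of_allParts` (the four parts as hypotheses ⟹ the gate at every genus), and
  `ShadowApproximation_of : ShadowApproximation` (the route decl, BY NAME, from the four stubs).
* Certificates (sorry-free): the standard triple is framed / σ-standard / equivalent
  (`framing_std`, `sigmaStandard_std`, `equivalent_std`), and `parts_of_gate` / `parts_of_crux`: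
  the crux implies every stub at every genus — NO STUB IS FALSER THAN THE CRUX (a refutation of any
  stub refutes `ShadowApproximation`; route kill criterion 3: restate stably).

Disproof.lean (v4, gen 2 cycle 2) honoured: §3 `shadowApproximation_false_without_isGroupTrisection`
/ `not_iso_of_shadows_only` (junk `(N₀,N₁,N₂ ⊓ ker θ)`, landed `Negative/ShadowsOnlyFalse.lean`,
imported here) — `H = IsGroupTrisection` is used at `stub_constantAvatar*` (a framing `φ₂` with kernel
`K₂` into the FREE group `H m 2` exists only because `S ⧸ K₂` is free: exactly the field
`free_quotient 2` the junk violates, `Negative/ShadowsOnlyFalseFields.lean`), and every avatar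
statement quantifies over framed triples, which are group trisections of `{1}` automatically (triage
N3, AvatarKernels.lean); `junk_not_equivalent` below checks the junk against the avatar statements.
§6 (units obstruction, `not_strongShadowApproximation` / `not_levelSymmetriesLift`, unit twist `δ` at
level `M₅`, `Negative/UnitTwist.lean`): honoured — NO stub asks the output `α`/`β` to be congruent to
the input level standardisation `ψ_M`, and no level symmetry is asked to lift to `Aut S` or `Aut F`
(triage r1-3 (b)); `hS` enters `stub_separation` verbatim and its conclusion is up to `±Aut_Λ`, not up
to level symmetries. §7 (`eq_of_idShadows`: identity shadows + separability force equality) locates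
the whole difficulty in the `M`-dependence of `ψ_M` — which is exactly what `stub_separation` must
absorb into ONE stable equivalence.
-/

noncomputable section

namespace Summit.SmoothPoincare4.SmoothPoincare4.Cruxes.ShadowApproximation.EpiClassLivingston

set_option linter.dupNamespace false

open Literature.Topology.FourManifolds
open Summit.SmoothPoincare4.SmoothPoincare4.Theses.CongruenceShadows (ShadowApproximation)
open Summit.SmoothPoincare4.SmoothPoincare4.Theorems.ShadowApproximation.EpiClassLivingston

/-! ## 0. Vocabulary

All objects (`S`, `N`, `H`, `T`, `stdPhi`, `Pstd`, `Pairs`, `Shadows`, `IsFraming`, `collapse3`,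
`collapseIter`, `StablyEquivalent`, `SigmaStandard`, `Equivalent`, `ConstantAvatarAt`, `SeparationAt`,
`CancellationAt`) live in the landed vocabulary file
`Theorems/CongruenceShadowsShadowApproximationEpiClassLivingstonDefs.lean` (namespace
`…Theorems.ShadowApproximation.EpiClassLivingston`, opened below), so that the registered stub
signatures and the stub files `Theorems/CongruenceShadowsShadowApproximationStub*.lean` refer to ONE
set of declarations. -/

/-- WHAT `hS` HANDS OVER, LEVEL BY LEVEL (triage r1-3 (b) made explicit; cf. the unit twist `δ` of
`Negative/UnitTwist.lean`): an automorphism `ψ` of `S` and the isomorphisms of the FINITE level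
avatars `S ⧸ NᵢM ≃* S ⧸ KᵢM` it induces — level symmetries between finite quotients, not
automorphisms of one fixed `F/M̄`, and never asked to lift to `Aut S` or `Aut F`. `stub_separation`
starts from exactly this datum. -/
theorem levelAvatars_of_shadows {m : ℕ} {K : TrisectionKernels (3 + 3 * m)} [∀ i, (K i).Normal]
    (hS : ∀ M : Subgroup (S m), M.Characteristic → M.FiniteIndex →
      ∃ ψ : S m ≃* S m, ∀ i : Fin 3, (N m i ⊔ M).map ψ.toMonoidHom = K i ⊔ M)
    (M : Subgroup (S m)) [hM : M.Characteristic] [hMf : M.FiniteIndex] :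
    ∃ (ψ : S m ≃* S m) (Ξ : ∀ i : Fin 3, S m ⧸ (N m i ⊔ M) ≃* S m ⧸ (K i ⊔ M)),
      ∀ (i : Fin 3) (s : S m), Ξ i (s : S m ⧸ (N m i ⊔ M)) = (ψ s : S m ⧸ (K i ⊔ M)) := by
  obtain ⟨ψ, hψ⟩ := hS M hM hMf
  exact ⟨ψ, fun i => QuotientGroup.congr (N m i ⊔ M) (K i ⊔ M) ψ (hψ i), fun i s => rfl⟩

/-- READ-BACK: the crux is literally `∀ m K, IsGroupTrisection → Pairs → Shadows → Iso N K`. -/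
theorem crux_iff :
    ShadowApproximation ↔ ∀ (m : ℕ) (K : TrisectionKernels (3 + 3 * m)),
      IsGroupTrisection (3 + 3 * m) (m + 1) (PUnit : Type) K → Pairs m K → Shadows m K →
        TrisectionKernels.Iso (N m) K :=
  Iff.rfl

/-! ## 2. Registered stubs -/

/-- STUB 1a · `stub_latticeIdentity` · the LATTICE IDENTITY at type `(3,1)` (ideator-2's first
lemma `tripleMeetCommutator_holds`, re-derived by triage r1-3 N2 as `[S,S] ≤ Kᵢ[Kⱼ,Kₗ]`): for every
`(3,1)` group trisection `K` of `{1}` and every labelling `{i,j,l} = {0,1,2}`,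
`[S,S] ≤ Kᵢ ⊔ (Kⱼ ⊓ Kₗ)`. Proof (5 lines on paper): in `S̄ = S ⧸ (Kᵢ ⊔ ⁅Kⱼ,Kₗ⁆)` the images `K̄ⱼ`,
`K̄ₗ` commute elementwise, `S̄ = K̄ⱼK̄ₗ` (`triple`: `Kᵢ ⊔ Kⱼ ⊔ Kₗ = ⊤`, all normal), `K̄ⱼ ∩ K̄ₗ` is
central, and `K̄ⱼ ⧸ (K̄ⱼ ∩ K̄ₗ) ≅ S̄ ⧸ K̄ₗ` is a quotient of `S ⧸ (Kᵢ ⊔ Kₗ) ≅ ℤ`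
(`free_pairQuotient`, rank `1`), hence cyclic, so `K̄ⱼ` (central-by-cyclic) is abelian, likewise
`K̄ₗ`, so `S̄` is abelian: `[S,S] ≤ Kᵢ ⊔ ⁅Kⱼ,Kₗ⁆ ≤ Kᵢ ⊔ (Kⱼ ⊓ Kₗ)` (`Subgroup.commutator_le_inf` for
normal `Kⱼ, Kₗ`). Consequence used by Stub 1c: the joint image `Φ_K(S) ≤ Π π₁(Hᵢ)` contains
`γ₂(π₁H₀) × γ₂(π₁H₁) × γ₂(π₁H₂)`, so it is the preimage of its ABELIAN image. Size M, provable now.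
Stated over tree notions only (lands verbatim as a Theorems file). -/
theorem stub_latticeIdentity :
    ∀ K : TrisectionKernels 3, IsGroupTrisection 3 1 (PUnit : Type) K →
      ∀ i j l : Fin 3, i ≠ j → j ≠ l → i ≠ l →
        ⁅(⊤ : Subgroup (SurfaceGroup 3)), (⊤ : Subgroup (SurfaceGroup 3))⁆ ≤ K i ⊔ (K j ⊓ K l) := by
  sorry

/-- STUB 1b · `stub_autFreeGroupRealisesGL` · **every invertible integer `3 × 3` matrix is the
abelianisation of an automorphism of `F₃`** (`Aut Fₙ ↠ GLₙ(ℤ)`: Nielsen 1924; Lyndon–Schupp,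
*Combinatorial Group Theory*, Ch. I Prop. 4.4; Magnus–Karrass–Solitar §3.5 Cor. N1). Row `i` of `M`
is the exponent-sum vector of `θ(xᵢ)`. Proof: `GL₃(ℤ)` is generated by the elementary matrices
`1 + e_{kl}` (`k ≠ l`) and the sign changes (Euclid on a column, then induction / Mathlib's
`SpecialLinearGroup.SL2Z_generators` for the `2 × 2` block), and these are the abelianisations of the
elementary Nielsen automorphisms `nielsenMul k l` (`xₖ ↦ xₖxₗ`) and `nielsenInv k` (`xₖ ↦ xₖ⁻¹`) of
`Literature/Topology/FourManifolds/BalancedPresentationBasisChange.lean` (composition multiplies the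
matrices). A published theorem: to be landed under `Literature/GroupTheory/CombinatorialGroupTheory/`
(general `n` if convenient) and quoted here at `n = 3`. Size M. -/
theorem stub_autFreeGroupRealisesGL :
    ∀ M : Matrix (Fin 3) (Fin 3) ℤ, IsUnit M.det →
      ∃ θ : FreeGroup (Fin 3) ≃* FreeGroup (Fin 3), ∀ i j : Fin 3,
        Multiplicative.toAdd (FreeGroup.lift
          (fun k : Fin 3 => Multiplicative.ofAdd (Pi.single k (1 : ℤ) : Fin 3 → ℤ))
          (θ (FreeGroup.of i))) j = M i j := by
  sorry

/-- STUB 1c · `stub_framingZero` · the DICTIONARY at genus 3 from 1a and 1b: every Waldhausen-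
normalised (`Pairs`), shadow-standard (`Shadows`) `(3;1,1,1)` group trisection `K` of `{1}` admits a
framing `φ : Π i, S₃ →* S₃ ⧸ Nᵢ`, `ker φᵢ = Kᵢ`, with the STANDARD joint image `Pstd 0`
(`ConstantAvatarAt 0`). Proof plan (lead, checked on paper): (0) transport along `hW 0 1` to
`K₀ = N₀`, `K₁ = N₁`, `K₂ = β(N₂)` with `β ∈ Stab(N₀)` (`hW 0 2`); framings transport
(`φᵢ ∘ α⁻¹`, same range). (1) By 1a the joint image `P` of any kernel-correct triple
`(c₀q₀, c₁q₁, c₂q₂β⁻¹)` (`qᵢ = mod Nᵢ`, `cᵢ ∈ Aut(S ⧸ Nᵢ)`) contains `γ₂³`, so `P = Pstd 0` iff the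
ABELIAN images agree: `(c̄₀p₀, c̄₁p₁, c̄₂p₂β̄⁻¹)(ℤ⁶) = (p₀,p₁,p₂)(ℤ⁶)` in `(ℤ³)³`, `pᵢ : H₁(Σ₃) = ℤ⁶ →
ℤ⁶/Lᵢ`, `L₀ = ⟨a₀,a₁,b₂⟩`, `L₁ = ⟨a₀,b₁,a₂⟩`, `L₂' = β̄⟨b₀,a₁,a₂⟩`. (2) ABELIAN STANDARDNESS from `hS`
at the prime levels `M_p = ⋂ ker(S →* ZMod p) = [S,S]·Sᵖ` (characteristic, finite index; cf.
`Negative/UnitTwist.lean`'s `M5`): transporting the coordinate picture of `N` mod `p` by `ψ_p` gives,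
for every prime `p`, `(L₀∩L₁) + (L₀∩L₂') ≡ L₀ ∩ (L₁+L₂') (mod p)` and `L₀∩L₁∩L₂' ≡ 0`, hence
(Nakayama: a finite abelian group `G` with `pG = G` for all `p` is `0`) `L₀ ∩ (L₁ + L₂') =
(L₀∩L₁) ⊕ (L₀∩L₂')`, `L₀∩L₁∩L₂' = 0`, and symmetrically; with `ℤ⁶/(Lᵢ+Lⱼ) ≅ ℤ` (abelianised
`free_pairQuotient`) and `ΣLᵢ = ℤ⁶` (`triple`) this yields a basis `(u₀₁,u₀₂,u₁₂,w₀,w₁,w₂)` of `ℤ⁶`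
with `L₀ = ⟨u₀₁,u₀₂,w₀⟩`, `L₁ = ⟨u₀₁,u₁₂,w₁⟩`, `L₂' = ⟨u₀₂,u₁₂,w₂⟩` — the coordinate pattern of `N`
(`a₀,a₁,a₂,b₂,b₁,b₀`); so `g ∈ GL₆(ℤ)` carries `(L₀,L₁,L₂)` to `(L₀,L₁,L₂')` and induces
`c̄ᵢ ∈ GL(ℤ⁶/Lᵢ) ≅ GL₃(ℤ)` with `(c̄ᵢ)ᵢ ∘ p = p' ∘ g`, i.e. equal images. (3) Lift `c̄ᵢ` to
`cᵢ ∈ Aut(S ⧸ Nᵢ)` by 1b through `S ⧸ Nᵢ ≅ F₃` (`quotientEquivFreeGroupErase (s4Gens i)`), whose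
abelianisation is `ℤ³` (`Abelianization`, `FreeAbelianGroup.equivFinsupp`). Size L (Lean:
abelianisation of `S₃` as `ℤ⁶` — the relator is a product of commutators; `Subgroup.map` along
`QuotientGroup.mk'`; integer lattices as `AddSubgroup (Fin 6 → ℤ)`). Never falser than the crux
(`parts_of_gate` gives `ConstantAvatarAt 0` outright). -/
theorem stub_framingZero :
    (∀ K : TrisectionKernels 3, IsGroupTrisection 3 1 (PUnit : Type) K →
      ∀ i j l : Fin 3, i ≠ j → j ≠ l → i ≠ l →
        ⁅(⊤ : Subgroup (SurfaceGroup 3)), (⊤ : Subgroup (SurfaceGroup 3))⁆ ≤ K i ⊔ (K j ⊓ K l)) →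
    (∀ M : Matrix (Fin 3) (Fin 3) ℤ, IsUnit M.det →
      ∃ θ : FreeGroup (Fin 3) ≃* FreeGroup (Fin 3), ∀ i j : Fin 3,
        Multiplicative.toAdd (FreeGroup.lift
          (fun k : Fin 3 => Multiplicative.ofAdd (Pi.single k (1 : ℤ) : Fin 3 → ℤ))
          (θ (FreeGroup.of i))) j = M i j) →
    ConstantAvatarAt 0 := by
  sorry

/-- The dictionary at genus 3 (`ConstantAvatarAt 0`), composed from Stubs 1a, 1b, 1c. -/
theorem constantAvatarZero : ConstantAvatarAt 0 :=
  stub_framingZero stub_latticeIdentity stub_autFreeGroupRealisesGL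

/-- STUB 2 · `stub_constantAvatarPos` · `m ≥ 1`: the framed JOINT image of a normalised,
shadow-standard `(3+3m; m+1)` group trisection of `{1}` is the standard subgroup
`P_std,m ≤ Π F_{3(m+1)}` up to coordinate automorphisms. Nielsen-level statement (pairwise images are
standard fibre products by `hW`; the content is the simultaneous framing of the TRIPLE image), implied
by the crux, strictly weaker (it forgets the marking `S ↠ P_std,m`); tools: profinite rigidity of
finitely generated subgroups of free groups (M. Hall, Garrido–Jaikin-Zapirain) as in the sibling line
`free-shadow-tsystem`. Size XL / open. -/
theorem stub_constantAvatarPos : ∀ m : ℕ, 0 < m → ConstantAvatarAt m := by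
  sorry

/-- STUB 3 · `stub_separation` · SEPARATION (LOAD-BEARING): standard shadows ⟹ σ-standard.
Why plausible: the Livingston class is read by finite quotients (for FINITE targets it is the
complete stable invariant, DT06 Thm 6.11), `H₂(E_Λ;ℤ)` is a finitely generated torsion module over
`ℤ[ℤ³]` with explicit level symmetries, and orbit/genus questions for such modules are decidable with
a finite class set (Grunewald–Segal genre). Why it might fail: level symmetries exceed liftable ones
by units (route NUMBERS; `Negative/UnitTwist.lean`), so the levelwise orbit may be strictly coarser
than `±Aut_Λ·σ(Φ_N)`. FIRST TASK before proving (triage (a)): the kill-switch computation of the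
line card — if every admissible class is already `σ`-standard this stub is VACUOUS and the line is
costume. Implied by the crux (`parts_of_gate`). Size XL / research. -/
theorem stub_separation : ∀ m : ℕ, SeparationAt m := by
  sorry

/-- STUB 4 · `stub_cancellation` · CANCELLATION (RESIDUAL): σ-standard (+ normalised + shadow-
standard) ⟹ standard. It is the crux restricted to the σ-standard locus (one extra hypothesis),
i.e. `SPC4_g ∧` balanced 4-d Waldhausen`_g` there; its proper content is DESTABILISATION: a stable
equivalence is a bordism `W³` over `K(P_std,1) = E_Λ` between the two trisection diagrams, carrying
three properly embedded surface systems (transversality to the edge midpoints of the three roses) —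
attack by 3-manifold topology (Haken hierarchies of `W`, Stallings folding of the three maps
`W → R₃`). Note (line card §Cheapest falsifier): "bending" `Φ_N` along a STANDARD reducing curve
(conjugating the images of one standard handle by `p ∈ P_std`) keeps `σ` and is harmless — onto
`P_std` forces the coordinatewise partial conjugations to be automorphisms, so the kernel triple is
unchanged; genuinely new σ-standard markings need a NON-standard reducing curve of `N` (reducing-curve
uniqueness for the genus-3 trisection of `S⁴`) or a stabilise–twist–destabilise. Size: open-problem. -/
theorem stub_cancellation : ∀ m : ℕ, CancellationAt m := by
  sorry

/-! ## 3. Composition (sorry-free): the four stubs prove the crux BY NAME -/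

/-- Kernel bookkeeping: if `Φ_N = β ∘ Φ_K ∘ θ` then `θ(Nᵢ) = Kᵢ`, i.e. `Iso N K`. -/
theorem iso_of_equivalent {m : ℕ} {K : TrisectionKernels (3 + 3 * m)}
    {φ : ∀ i : Fin 3, S m →* H m i} (hker : ∀ i, (φ i).ker = K i)
    (h : Equivalent m (MonoidHom.pi φ)) : TrisectionKernels.Iso (N m) K := by
  obtain ⟨θ, β, hθ⟩ := h
  refine ⟨θ, fun i => ?_⟩
  have key : ∀ s : S m, s ∈ N m i ↔ θ s ∈ K i := fun s => by
    have h1 := congrFun (hθ s) i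
    simp only [stdPhi_apply, MulEquiv.piCongrRight_apply, MonoidHom.pi_apply] at h1
    rw [← hker i, MonoidHom.mem_ker, ← QuotientGroup.eq_one_iff, h1, MulEquiv.map_eq_one_iff]
  have hN : N m i = (K i).comap θ.toMonoidHom := by
    ext s
    simpa using key s
  rw [hN, Subgroup.map_comap_eq_self_of_surjective θ.surjective]

/-- **The gate at genus `3 + 3m` from the three parts**: frame (`ConstantAvatar`), separate
(`SigmaStandard`), cancel (`Equivalent`), read off the kernels (`Iso`). -/
theorem gate_of_parts (m : ℕ) (hA : ConstantAvatarAt m) (hSep : SeparationAt m)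
    (hC : CancellationAt m) (K : TrisectionKernels (3 + 3 * m))
    (hK : IsGroupTrisection (3 + 3 * m) (m + 1) (PUnit : Type) K) (hW : Pairs m K)
    (hS : Shadows m K) : TrisectionKernels.Iso (N m) K := by
  obtain ⟨φ, hφ⟩ := hA K hK hW hS
  exact iso_of_equivalent hφ.1 (hC K φ hK hW hS hφ (hSep K φ hK hW hS hφ))

/-- The four parts, as implications, give the gate at every genus (conclusion spelled out, so that
exactly one theorem of this file — `ShadowApproximation_of` — concludes the crux by name). -/
theorem gate_of_allParts (h0 : ConstantAvatarAt 0) (hpos : ∀ m : ℕ, 0 < m → ConstantAvatarAt m)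
    (hsep : ∀ m : ℕ, SeparationAt m) (hcan : ∀ m : ℕ, CancellationAt m) :
    ∀ (m : ℕ) (K : TrisectionKernels (3 + 3 * m)),
      IsGroupTrisection (3 + 3 * m) (m + 1) (PUnit : Type) K → Pairs m K → Shadows m K →
        TrisectionKernels.Iso (N m) K := by
  intro m K hK hW hS
  rcases Nat.eq_zero_or_pos m with rfl | hm
  · exact gate_of_parts 0 h0 (hsep 0) (hcan 0) K hK hW hS
  · exact gate_of_parts m (hpos m hm) (hsep m) (hcan m) K hK hW hS

/-- **The skeleton concludes the crux BY NAME.** `CongruenceShadows.ShadowApproximation`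
(stmt-SmoothPoincare4-14595) from the six registered stubs `stub_latticeIdentity`,
`stub_autFreeGroupRealisesGL`, `stub_framingZero` (together: the dictionary `constantAvatarZero`),
`stub_constantAvatarPos`, `stub_separation`, `stub_cancellation` and the sorry-free glue
(`gate_of_parts`: frame → separate → cancel → read off the kernels); sorries only inside `stub_*`. -/
theorem ShadowApproximation_of :
    _root_.Summit.SmoothPoincare4.SmoothPoincare4.Theses.CongruenceShadows.ShadowApproximation := by
  intro m K hK hW hS
  rcases Nat.eq_zero_or_pos m with rfl | hm
  · exact gate_of_parts 0 constantAvatarZero (stub_separation 0) (stub_cancellation 0) K hK hW hS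
  · exact gate_of_parts m (stub_constantAvatarPos m hm) (stub_separation m) (stub_cancellation m)
      K hK hW hS

/-! ## 4. Certificates (sorry-free): non-vacuity, and no stub is falser than the crux -/

section Certificates

variable (m : ℕ)

/-- The standard triple is framed by the quotient maps themselves. -/
theorem framing_std : IsFraming m (N m) (fun i => QuotientGroup.mk' (N m i)) :=
  ⟨fun i => QuotientGroup.ker_mk' (N m i), rfl⟩

/-- The standard avatar is equivalent to itself. -/
theorem equivalent_std : Equivalent m (stdPhi m) :=
  ⟨MulEquiv.refl _, fun _ => MulEquiv.refl _, fun _ => rfl⟩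

/-- `Equivalent ⟹ SigmaStandard` (no stabilisation needed: `n = 0`). -/
theorem sigmaStandard_of_equivalent {m : ℕ} {Φ : S m →* T m} (h : Equivalent m Φ) :
    SigmaStandard m Φ := by
  obtain ⟨θ, β, hθ⟩ := h
  exact ⟨β, 0, θ, MonoidHom.ext fun x => (hθ x).symm⟩

/-- NON-VACUITY: the standard avatar is σ-standard. -/
theorem sigmaStandard_std : SigmaStandard m (stdPhi m) :=
  sigmaStandard_of_equivalent (equivalent_std m)

variable {m}

/-- Each coordinate of a framing is onto (the joint image `P_std` projects onto each `π₁(Hᵢ)`). -/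
theorem framing_surjective {K : TrisectionKernels (3 + 3 * m)} {φ : ∀ i : Fin 3, S m →* H m i}
    (hφ : IsFraming m K φ) (i : Fin 3) : Function.Surjective (φ i) := by
  intro y
  obtain ⟨t, rfl⟩ := QuotientGroup.mk_surjective y
  have ht : stdPhi m t ∈ (MonoidHom.pi φ).range := by
    rw [hφ.2]
    exact ⟨t, rfl⟩
  obtain ⟨s, hs⟩ := ht
  exact ⟨s, by simpa using congrFun hs i⟩

/-- From `Iso N K`, every framing of `K` is equivalent to the standard avatar: `φᵢ ∘ α` is onto
`π₁(Hᵢ)` with kernel `Nᵢ`, so it IS `βᵢ ∘ (mod Nᵢ)` for a unique `βᵢ ∈ Aut π₁(Hᵢ)`. -/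
theorem equivalent_of_iso {K : TrisectionKernels (3 + 3 * m)} {φ : ∀ i : Fin 3, S m →* H m i}
    (hφ : IsFraming m K φ) (h : TrisectionKernels.Iso (N m) K) :
    Equivalent m (MonoidHom.pi φ) := by
  obtain ⟨α, hα⟩ := h
  have hsurj : ∀ i, Function.Surjective ((φ i).comp α.toMonoidHom) := fun i =>
    (framing_surjective hφ i).comp α.surjective
  have hker : ∀ i, ((φ i).comp α.toMonoidHom).ker = N m i := by
    intro i
    ext s
    rw [MonoidHom.mem_ker, MonoidHom.comp_apply, ← MonoidHom.mem_ker, hφ.1 i, ← hα i]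
    simp
  let β : ∀ i : Fin 3, H m i ≃* H m i := fun i =>
    (QuotientGroup.quotientMulEquivOfEq (hker i).symm).trans
      (QuotientGroup.quotientKerEquivOfSurjective _ (hsurj i))
  have hβ : ∀ (i : Fin 3) (s : S m), β i (s : H m i) = φ i (α s) := fun _ _ => rfl
  refine ⟨α, fun i => (β i).symm, fun s => funext fun i => ?_⟩
  simp only [stdPhi_apply, MulEquiv.piCongrRight_apply, MonoidHom.pi_apply]
  rw [MulEquiv.eq_symm_apply, hβ]

/-- From `Iso N K`, `K` is framed: `φᵢ := (mod Nᵢ) ∘ α⁻¹`. -/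
theorem framing_of_iso {K : TrisectionKernels (3 + 3 * m)} (h : TrisectionKernels.Iso (N m) K) :
    ∃ φ : ∀ i : Fin 3, S m →* H m i, IsFraming m K φ := by
  obtain ⟨α, hα⟩ := h
  refine ⟨fun i => (QuotientGroup.mk' (N m i)).comp α.symm.toMonoidHom, fun i => ?_, ?_⟩
  · ext s
    rw [MonoidHom.mem_ker, MonoidHom.comp_apply, QuotientGroup.mk'_apply, QuotientGroup.eq_one_iff,
      ← hα i]
    exact Subgroup.mem_map_equiv.symm
  · have hpi : (MonoidHom.pi fun i => (QuotientGroup.mk' (N m i)).comp α.symm.toMonoidHom) =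
        (stdPhi m).comp α.symm.toMonoidHom := MonoidHom.ext fun _ => rfl
    rw [hpi, MonoidHom.range_comp, MonoidHom.range_eq_top.2 α.symm.surjective,
      ← MonoidHom.range_eq_map]
    rfl

/-- **NO STUB IS FALSER THAN THE CRUX (at each genus).** The genus-`3+3m` gate — the crux's own
conclusion pattern — implies all three parts at that genus. -/
theorem parts_of_gate (m : ℕ)
    (gate : ∀ K : TrisectionKernels (3 + 3 * m),
      IsGroupTrisection (3 + 3 * m) (m + 1) (PUnit : Type) K → Pairs m K → Shadows m K →
        TrisectionKernels.Iso (N m) K) :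
    ConstantAvatarAt m ∧ SeparationAt m ∧ CancellationAt m :=
  ⟨fun K hK hW hS => framing_of_iso (gate K hK hW hS),
    fun K _ hK hW hS hφ => sigmaStandard_of_equivalent (equivalent_of_iso hφ (gate K hK hW hS)),
    fun K _ hK hW hS hφ _ => equivalent_of_iso hφ (gate K hK hW hS)⟩

/-- Hence the crux implies the statements of all four stubs: the skeleton is an EQUIVALENT
reformulation of `ShadowApproximation` (with `ShadowApproximation_of`). -/
theorem parts_of_crux
    (h : _root_.Summit.SmoothPoincare4.SmoothPoincare4.Theses.CongruenceShadows.ShadowApproximation) :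
    ConstantAvatarAt 0 ∧ (∀ m : ℕ, 0 < m → ConstantAvatarAt m) ∧ (∀ m : ℕ, SeparationAt m) ∧
      (∀ m : ℕ, CancellationAt m) :=
  ⟨(parts_of_gate 0 (h 0)).1, fun m _ => (parts_of_gate m (h m)).1,
    fun m => (parts_of_gate m (h m)).2.1, fun m => (parts_of_gate m (h m)).2.2⟩

/-- CHECK AGAINST THE LANDED NEGATIVE LEMMA (`Negative/ShadowsOnlyFalse.lean`): the disprover's junk
triple `J = (N₀, N₁, N₂ ⊓ ker θ)` has all finite shadows standard yet `¬ Iso N J`; the avatar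
statements cannot be fed with it — by `iso_of_equivalent`, NO framing of `J` is equivalent to the
standard avatar (and in fact `J` has no framing at all: `S ⧸ J₂` is not free,
`Negative/ShadowsOnlyFalseFields.junk_not_free_quotient_two`). -/
theorem junk_not_equivalent (φ : ∀ i : Fin 3, S 0 →* H 0 i)
    (hker : ∀ i, (φ i).ker =
      Summit.SmoothPoincare4.SmoothPoincare4.Theorems.ShadowApproximation.Negative.junk i) :
    ¬ Equivalent 0 (MonoidHom.pi φ) := fun h =>
  Summit.SmoothPoincare4.SmoothPoincare4.Theorems.ShadowApproximation.Negative.not_iso_junk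
    (iso_of_equivalent hker h)

end Certificates

end Summit.SmoothPoincare4.SmoothPoincare4.Cruxes.ShadowApproximation.EpiClassLivingston

end
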